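import Summits.BirchSwinnertonDyer.BirchSwinnertonDyer.Theorems.PrintCFramBottomClassIndexLawFiveLeLevelCriterion
import HarnessLib

/-!
# Route `PrintCFram`, crux C2 `BottomClassIndexLawFiveLe` (stmt-BirchSwinnertonDyer-20372), line
# `eisenstein-resource-bdp-line` (registry v21/v22: `stub_bsdp_of_level` = B1-level): **THE LEVEL BINDER IN ELEMENTARY CURRENCY, III —
# LOGARITHM CURRENCY: `ι P ∈ p^k W(ℚ_p)` iff `‖log P‖ ≤ p⁻ᵏ`; the exact level is `v_p(log(ι P))`** (ty3's engine A, in the kernel)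
# (cell `bsd-print-cfram`, width seat `bsd-line-cfram-p1-w6` g5; helper `--supports` 20372; 0 defs, 0 facts, 0 sorry)

HONEST FRAMING. Nothing about BSD is proved here and no stub is closed. Companion of `…LevelCriterion` / `…LevelCriterionExactLevel`:
the same level binders in the currency of the tree's logarithm `Rank1Residual.Additive.LocalLog.padicLog : W(ℚ_p) →+ ℚ_p` (kernel =
torsion, image `p^{t − v_p c_p} ℤ_p`; at an additive `p ≥ 5` with `W(ℚ_p)[p] = 0` the image is `ℤ_p` EXACTLY). This is the convention
of ty3's display file `X12/CMRamifiedLevelsFiveLe` («`n = v_p(log_ω([m]G)/m)`», engine A = PARI `ellpadiclog`), now a theorem: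
for `X/ℚ_p` integral elliptic with `log(X(ℚ_p)) = ℤ_p` and `p ∤ #X(ℚ_p)_tors`, **`P ∈ p^k X(ℚ_p) ⟺ ‖log P‖ ≤ p⁻ᵏ`** (every `k`), hence the
crux's binder pair «`∃ Q, p^n • Q = P` ∧ `∀ Q, p^{n+1} • Q ≠ P`» **⟺ `‖log P‖ = p⁻ⁿ`**; specialised to `W/ℚ` globally minimal with
`Addv W p`, `p ≥ 5`, `W(ℚ_p)[p] = 0`, and to the CM-ramified class member. (The identification of `padicLog` with the formal-group
logarithm `log_ω` is the tree's `Additive/PadicLogFormalGroup.lean`, not used here.)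

* §1 `norm_padicLog_le_one_of_range`, **`exists_pow_nsmul_eq_iff_norm_padicLog_le`**, **`level_iff_norm_padicLog_eq`** (`X/ℚ_p`).
* §2 `range_padicLog_eq_of_addv` (`log(W(ℚ_p)) = ℤ_p`), **`exists_pow_nsmul_eq_iff_norm_padicLog_le_of_addv`**,
  **`level_iff_norm_padicLog_eq_of_cmRamified`** (`W/ℚ`, the class member, `P = ι g` any local point).

THEOREMS ONLY; no definition, no named fact, no `sorry`. BSD is not proved by any of this; no summit statement is proved by this seat.
References: [SilvermanAEC2009] IV.6.4, VII.6.3; [Kim2022StructureSelmer] §3.2.3, Lemma 3.10.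
-/

set_option autoImplicit false
-- `…BirchSwinnertonDyer.BirchSwinnertonDyer.Theorems…` is the problem's mandated namespace (D-0017).
set_option linter.dupNamespace false

noncomputable section

open scoped Classical

namespace Summit.BirchSwinnertonDyer.BirchSwinnertonDyer.Theorems.PrintCFram.LevelCriterion

open WeierstrassCurve Literature.NumberTheory.EllipticCurves Literature.NumberTheory.EllipticCurves.Rank1Residual
open Summit.BirchSwinnertonDyer.Rank1Residual.Additive.LocalLog

/-! ## §1 `X/ℚ_p` integral elliptic with `log(X(ℚ_p)) = ℤ_p` and `p ∤ #X(ℚ_p)_tors` -/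

section Local

variable {p : ℕ} [hp : Fact p.Prime] (X : WeierstrassCurve ℚ_[p]) [X.IsIntegral ℤ_[p]] [X.IsElliptic]

/-- `log(X(ℚ_p)) = ℤ_p` ⟹ `‖log P‖ ≤ 1` for every local point, and every `u ∈ ℚ_p` with `‖u‖ ≤ 1` is a value `log Q`. [cite: SilvermanAEC2009, VII.6.3] -/
theorem norm_padicLog_le_one_iff_of_range (hrange : (padicLog X).range = (Submodule.span ℤ_[p] {(1 : ℚ_[p])}).toAddSubgroup)
    (u : ℚ_[p]) : ‖u‖ ≤ 1 ↔ ∃ Q : X.toAffine.Point, padicLog X Q = u := by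
  have h : u ∈ (padicLog X).range ↔ ‖u‖ ≤ 1 := by
    rw [hrange, Submodule.mem_toAddSubgroup, Submodule.mem_span_singleton]
    constructor
    · rintro ⟨a, rfl⟩
      rw [Algebra.smul_def, mul_one]
      exact a.2
    · intro hu
      exact ⟨⟨u, hu⟩, by rw [Algebra.smul_def, mul_one]; rfl⟩
  rw [← h]
  rfl

/-- **`P ∈ p^k X(ℚ_p)` iff `‖log P‖ ≤ p⁻ᵏ`** (every `k`), for `X/ℚ_p` integral elliptic with `log(X(ℚ_p)) = ℤ_p` exactly and
`p ∤ #X(ℚ_p)_tors`: (⟹) `log P = p^k log Q`, `‖log Q‖ ≤ 1`; (⟸) `log P / p^k ∈ ℤ_p` is a value `log Q`, and `P − p^k Q` lies in the kernel =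
torsion, of order prime to `p^k` (`exists_nsmul_eq_of_apply_eq_nsmul`). [cite: SilvermanAEC2009, IV.6.4 and VII.6.3] -/
theorem exists_pow_nsmul_eq_iff_norm_padicLog_le
    (hrange : (padicLog X).range = (Submodule.span ℤ_[p] {(1 : ℚ_[p])}).toAddSubgroup)
    (htc : ¬ p ∣ Nat.card (AddCommGroup.torsion X.toAffine.Point)) (P : X.toAffine.Point) (k : ℕ) :
    (∃ Q : X.toAffine.Point, p ^ k • Q = P) ↔ ‖padicLog X P‖ ≤ ((p : ℝ)⁻¹) ^ k := by
  have hpR : (0 : ℝ) < p := by exact_mod_cast hp.out.pos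
  have hp0 : (p : ℚ_[p]) ≠ 0 := Nat.cast_ne_zero.mpr hp.out.ne_zero
  have hnp : ‖(p : ℚ_[p]) ^ k‖ = ((p : ℝ)⁻¹) ^ k := by rw [norm_pow, Padic.norm_p]
  constructor
  · rintro ⟨Q, rfl⟩
    have hQ : ‖padicLog X Q‖ ≤ 1 := (norm_padicLog_le_one_iff_of_range X hrange _).mpr ⟨Q, rfl⟩
    rw [map_nsmul, nsmul_eq_mul, Nat.cast_pow, norm_mul, hnp]
    exact mul_le_of_le_one_right (pow_nonneg (inv_nonneg.mpr hpR.le) k) hQ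
  · intro hP
    have hy : ‖padicLog X P / (p : ℚ_[p]) ^ k‖ ≤ 1 := by
      rw [norm_div, hnp, div_le_one (pow_pos (inv_pos.mpr hpR) k)]
      exact hP
    obtain ⟨Q, hQ⟩ := (norm_padicLog_le_one_iff_of_range X hrange _).mp hy
    have hPQ : padicLog X P = (p ^ k : ℕ) • padicLog X Q := by
      rw [hQ, nsmul_eq_mul, Nat.cast_pow, mul_div_cancel₀ _ (pow_ne_zero k hp0)]
    refine exists_nsmul_eq_of_apply_eq_nsmul (padicLog X) (c := Nat.card (AddCommGroup.torsion X.toAffine.Point))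
      (fun T hT => natCard_torsion_nsmul_eq_zero_of_padicLog_eq_zero X hT) ?_ hPQ
    exact Nat.Coprime.pow_right k (Nat.Coprime.symm ((Nat.Prime.coprime_iff_not_dvd hp.out).mpr htc))

/-- **THE EXACT LEVEL IS `v_p(log P)`**: the binder pair «`∃ Q, p^n • Q = P` ∧ `∀ Q, p^{n+1} • Q ≠ P`» holds iff `‖log P‖ = p⁻ⁿ`
(same hypotheses). [cite: SilvermanAEC2009, IV.6.4 and VII.6.3] -/
theorem level_iff_norm_padicLog_eq
    (hrange : (padicLog X).range = (Submodule.span ℤ_[p] {(1 : ℚ_[p])}).toAddSubgroup)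
    (htc : ¬ p ∣ Nat.card (AddCommGroup.torsion X.toAffine.Point)) (P : X.toAffine.Point) (n : ℕ) :
    ((∃ Q : X.toAffine.Point, p ^ n • Q = P) ∧ (∀ Q : X.toAffine.Point, p ^ (n + 1) • Q ≠ P)) ↔
      ‖padicLog X P‖ = ((p : ℝ)⁻¹) ^ n := by
  have hne : (∀ Q : X.toAffine.Point, p ^ (n + 1) • Q ≠ P) ↔ ¬ ‖padicLog X P‖ ≤ ((p : ℝ)⁻¹) ^ (n + 1) := by
    rw [← exists_pow_nsmul_eq_iff_norm_padicLog_le X hrange htc P (n + 1), not_exists]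
  rw [exists_pow_nsmul_eq_iff_norm_padicLog_le X hrange htc P n, hne, ← WeierstrassCurve.padicNorm_lt_inv_pow_iff_le, not_lt]
  exact ⟨fun h => le_antisymm h.1 h.2, fun h => ⟨h.le, h.ge⟩⟩

end Local


/-! ## §2 `W/ℚ` globally minimal, ADDITIVE at `p ≥ 5`, `W(ℚ_p)[p] = 0`; the CM-ramified class member -/

section Rat

variable (W : WeierstrassCurve ℚ) [W.IsElliptic] [W.IsGloballyMinimal] (p : ℕ) [hp : Fact p.Prime]

/-- **`log(W(ℚ_p)) = ℤ_p` EXACTLY** for `W/ℚ` globally minimal, ADDITIVE at `p ≥ 5` with `W(ℚ_p)[p] = 0` (tree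
`range_padicLog_baseChange_of_addv_of_not_dvd`: image `p^{t − v_p c_p} ℤ_p`; here `t = 0` by Cauchy and `p ∤ c_p ≤ 4`).
[cite: Kim2022StructureSelmer, §3.2.3 and Lemma 3.10 (PDF pp. 16–17)] [cite: SilvermanAEC2009, VII.6.1 and VII.6.3] -/
theorem range_padicLog_eq_of_addv (hp5 : 5 ≤ p) (hadd : Addv W p)
    (htors : ∀ Q : (W.baseChange ℚ_[p]).toAffine.Point, p • Q = 0 → Q = 0) :
    (padicLog (W.baseChange ℚ_[p])).range = (Submodule.span ℤ_[p] {(1 : ℚ_[p])}).toAddSubgroup := by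
  haveI : (W.baseChange ℚ_[p]).IsElliptic := by rw [baseChange]; infer_instance
  have htc := not_dvd_natCard_torsion_of_forall_prime_nsmul (W.baseChange ℚ_[p]) htors
  have hcp : ¬ p ∣ (W.baseChange ℚ_[p]).localTamagawaNumber ℤ_[p] := by
    intro hdvd
    have h4 := localTamagawaNumber_padic_le_four_of_not_mult W p hadd.2
    have h0 := localTamagawaNumber_padic_ne_zero_holds p (W.baseChange ℚ_[p])
    have := Nat.le_of_dvd (Nat.pos_of_ne_zero h0) hdvd
    omega
  rw [range_padicLog_baseChange_of_addv_of_not_dvd W p hadd hcp, padicValNat.eq_zero_of_not_dvd htc, pow_zero]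

/-- **`P ∈ p^k W(ℚ_p)` iff `‖log P‖ ≤ p⁻ᵏ`** for every local point `P` and every `k` (`W/ℚ` globally minimal, `Addv W p`, `p ≥ 5`,
`W(ℚ_p)[p] = 0`). [cite: SilvermanAEC2009, IV.6.4 and VII.6.3] -/
theorem exists_pow_nsmul_eq_iff_norm_padicLog_le_of_addv (hp5 : 5 ≤ p) (hadd : Addv W p)
    (htors : ∀ Q : (W.baseChange ℚ_[p]).toAffine.Point, p • Q = 0 → Q = 0)
    (P : (W.baseChange ℚ_[p]).toAffine.Point) (k : ℕ) :
    (∃ Q : (W.baseChange ℚ_[p]).toAffine.Point, p ^ k • Q = P) ↔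
      ‖padicLog (W.baseChange ℚ_[p]) P‖ ≤ ((p : ℝ)⁻¹) ^ k := by
  haveI : (W.baseChange ℚ_[p]).IsElliptic := by rw [baseChange]; infer_instance
  exact exists_pow_nsmul_eq_iff_norm_padicLog_le (W.baseChange ℚ_[p]) (range_padicLog_eq_of_addv W p hp5 hadd htors)
    (not_dvd_natCard_torsion_of_forall_prime_nsmul (W.baseChange ℚ_[p]) htors) P k

/-- **The exact level of a local point is `v_p(log P)`** (`W/ℚ` globally minimal, `Addv W p`, `p ≥ 5`, `W(ℚ_p)[p] = 0`): the crux's binder pair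
holds iff `‖log P‖ = p⁻ⁿ`. [cite: SilvermanAEC2009, IV.6.4 and VII.6.3] -/
theorem level_iff_norm_padicLog_eq_of_addv (hp5 : 5 ≤ p) (hadd : Addv W p)
    (htors : ∀ Q : (W.baseChange ℚ_[p]).toAffine.Point, p • Q = 0 → Q = 0)
    (P : (W.baseChange ℚ_[p]).toAffine.Point) (n : ℕ) :
    ((∃ Q : (W.baseChange ℚ_[p]).toAffine.Point, p ^ n • Q = P) ∧
      (∀ Q : (W.baseChange ℚ_[p]).toAffine.Point, p ^ (n + 1) • Q ≠ P)) ↔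
      ‖padicLog (W.baseChange ℚ_[p]) P‖ = ((p : ℝ)⁻¹) ^ n := by
  haveI : (W.baseChange ℚ_[p]).IsElliptic := by rw [baseChange]; infer_instance
  exact level_iff_norm_padicLog_eq (W.baseChange ℚ_[p]) (range_padicLog_eq_of_addv W p hp5 hadd htors)
    (not_dvd_natCard_torsion_of_forall_prime_nsmul (W.baseChange ℚ_[p]) htors) P n

/-- **THE CM-RAMIFIED CLASS MEMBER, LOG CURRENCY** (ty3's engine-A convention «`n = v_p(log_ω(G))`» as a theorem): for `W/ℚ` globally minimal
with CM, `CMRamified W p`, `p ≥ 5`, and ANY local point `P ∈ W(ℚ_p)` (e.g. `ι g` for the generator), the crux's binder pair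
«`∃ Q, p^n • Q = P` ∧ `∀ Q, p^{n+1} • Q ≠ P`» holds iff `‖log P‖_p = p⁻ⁿ`. [cite: SilvermanAEC2009, IV.6.4, VII.6.1, VII.6.3]
[cite: SilvermanATAEC1994, Cor. IV.9.2(d) and App. A §3] -/
theorem level_iff_norm_padicLog_eq_of_cmRamified (hCM : W.HasCM) (hram : CMRamified W p) (h5 : 5 ≤ p)
    (P : (W.baseChange ℚ_[p]).toAffine.Point) (n : ℕ) :
    ((∃ Q : (W.baseChange ℚ_[p]).toAffine.Point, p ^ n • Q = P) ∧
      (∀ Q : (W.baseChange ℚ_[p]).toAffine.Point, p ^ (n + 1) • Q ≠ P)) ↔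
      ‖padicLog (W.baseChange ℚ_[p]) P‖ = ((p : ℝ)⁻¹) ^ n :=
  level_iff_norm_padicLog_eq_of_addv W p h5 (Summit.BirchSwinnertonDyer.Rank1Residual.X12.addv_of_hasCM_of_cmRamified' W p hCM hram)
    (RamifiedSevenEllipticUnits.prime_nsmul_eq_zero_padic_of_hasCM_of_cmRamified W p hCM h5 hram) P n

end Rat

end Summit.BirchSwinnertonDyer.BirchSwinnertonDyer.Theorems.PrintCFram.LevelCriterion

end
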